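import Literature.Probability.Percolation.SlabCircuitExtension
import Literature.Probability.Percolation.SlabCircuitSideCrossings
import Literature.Probability.Percolation.SlabRSWLemma311
import Literature.Probability.Percolation.SlabRSWProp39Iter
import HarnessLib

/-!
# Newman–Tassion–Wu 2017, Theorem 3.10 (3.65): the side crossings cost at most a constant factor
# more than the hub crossings — `P[sideCross_X] ≥ κ(c) · P[hubCross_X]`, `κ` free of `N`

Topic: `Literature/Probability/Percolation`. Eleventh file of the port of THEOREM 3.10 of
Newman–Tassion–Wu, *Critical percolation and the minimal spanning tree in slabs* (CPAM 70 (2017);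
arXiv:1512.09107), display (3.65): "`P[B(S₁') ⟷^{S₁'} R(S₁')] ≥ c₁ P[B(S₁) ⟷^{S₁} R(S₁)]` … the value
of `λ` depends on `c` through the constant `c₁` but does not depend on `n`".  In the port's square
ring (`SlabCircuitSideCrossings.lean`) each side `ringSide_X` is its hub strip `hub_X` extended by
`n+1` lattice lines at one end and `n+2` at the other; three applications of the linear one-block
extension `real_lr_extend_linear` (`SlabCircuitExtension.lean`; blocks `n+1`, `n+1`, `1`), placed by
translation / reflection / transposition, give

* `real_lr_extend_left_ge`, `real_lr_extend_right_ge` — one-block extensions of a long crossing of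
  an arbitrary horizontal strip of `n` rows, in place: `κ_m · P[[a,b] crossed] ≤ P[[a-m,b] crossed]`,
  `κ_m = (1-√(1-f(n-1,n-1)))² f(n-1+m, n-1) / (K₁²K₂)`;
* **`real_sideCross_ge_hubCross`** — for `n ≥ 52`, `N ≥ n`, `0 < p < 1` and `c ≤ f_p(2n, n-1)`
  (`0 ≤ c`): `κ(c)·P[hubCross_X] ≤ P[sideCross_X]` for the four sides, with
  `κ(c) = ((1-√(1-c))²·c/(K₁²K₂))³` INDEPENDENT of `N` (the input of (3.66)–(3.74):
  `P[hubCross]² ≤ (P[hubCross]/κ)·P[sideCross]`).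

## Sources

* C. M. Newman, V. Tassion, W. Wu, *Critical percolation and the minimal spanning tree in slabs*,
  Comm. Pure Appl. Math. 70 (2017) 2084–2120, arXiv:1512.09107: proof of Theorem 3.10, (3.65), and
  §3.3 (proof of Proposition 3.9) [NewmanTassionWu2017].
-/

noncomputable section

namespace Literature.Probability.Percolation

open MeasureTheory LatticeModels
open scoped LatticeModels

namespace NTW17

variable {k : ℕ}

/-! ## One-block extensions in place -/

/-- The GL0 constant `K₁² K₂` at `ρ = 4`. [cite: NewmanTassionWu2017, §3.2 (Theorem 3.6, Remark 3: h₀(x) ≥ c₀ x)] -/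
def glueK (k : ℕ) (p : unitInterval) : ℝ :=
  (1 + (2 / min (p : ℝ) (1 - p)) ^ (3 * ((5 * k + 4) * (2 * (6 * 4 + 4) + 1) ^ 2))) ^ 2 *
    (1 + (2 / min (p : ℝ) (1 - p)) ^ (3 * ((5 * k + 4) * (2 * (2 * (3 * 4 + 3)) + 1) ^ 2)))

/-- `glueK > 0`. [cite: NewmanTassionWu2017, §3.2 (Theorem 3.6, Remark 3)] -/
theorem glueK_pos (k : ℕ) (p : unitInterval) : 0 < glueK k p := by
  have hb : 0 ≤ 2 / min (p : ℝ) (1 - p) :=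
    div_nonneg (by norm_num) (le_min p.2.1 (sub_nonneg.2 p.2.2))
  have h1 : 0 < 1 + (2 / min (p : ℝ) (1 - p)) ^ (3 * ((5 * k + 4) * (2 * (6 * 4 + 4) + 1) ^ 2)) := by
    exact add_pos_of_pos_of_nonneg one_pos (pow_nonneg hb _)
  have h2 : 0 < 1 + (2 / min (p : ℝ) (1 - p)) ^ (3 * ((5 * k + 4) * (2 * (2 * (3 * 4 + 3)) + 1) ^ 2)) := by
    exact add_pos_of_pos_of_nonneg one_pos (pow_nonneg hb _)
  exact mul_pos (pow_pos h1 2) h2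

/-- The one-block extension factor `κ_m = (1 - √(1 - f(n-1,n-1)))² · f(n-1+m, n-1) / (K₁² K₂)`.
[cite: NewmanTassionWu2017, Theorem 3.10 (proof, (3.65): the constant c₁)] -/
def extFactor (k : ℕ) (p : unitInterval) (n m : ℕ) : ℝ :=
  (1 - Real.sqrt (1 - crossingProb k p (n - 1) (n - 1))) ^ 2 * crossingProb k p (n - 1 + m) (n - 1) / glueK k p

/-- **Left one-block extension in place**: for a horizontal strip of the `n` rows `[r, r+n-1]`
(`n ≥ 52`), a long box `[a, b]` with `b - a ≥ n - 1` and `b - a > (n-1)/2 + 24`, and `m ≥ 1`: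
`κ_m · P[[a,b] crossed] ≤ P[[a-m, b] crossed]`. [cite: NewmanTassionWu2017, Theorem 3.10 (proof, (3.65))] -/
theorem real_lr_extend_left_ge (hk : 1 ≤ k) {n : ℕ} (hn : 52 ≤ n) {a b r : ℤ} (hab : (n : ℤ) - 1 ≤ b - a)
    {m : ℕ} (hm : 1 ≤ m) (p : unitInterval) (hp0 : 0 < (p : ℝ)) (hp1 : (p : ℝ) < 1) :
    extFactor k p n m * (bondPercolation (slabGraph 3 k) p).real
        (slabConn k (boxR a b r (r + n - 1)) {z | z.1 = a} {z | z.1 = b}) ≤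
      (bondPercolation (slabGraph 3 k) p).real
        (slabConn k (boxR (a - m) b r (r + n - 1)) {z | z.1 = a - m} {z | z.1 = b}) := by
  set P := bondPercolation (slabGraph 3 k) p with hP
  -- NTW's parameters: rows `[0, n']`, `n' = n - 1`, `h = ⌊n'/2⌋`, `M = b - a - n'`
  set n' : ℤ := (n : ℤ) - 1 with hn'
  set h : ℤ := n' / 2 with hh
  have hh2 : 2 ≤ h := by omega
  have hhn : 2 * h ≤ n' := by omega
  have hhn' : n' ≤ 2 * h + 1 := by omega
  set M : ℤ := b - a - n' with hM
  have hM0 : 0 ≤ M := by omega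
  have hsepM : h + 4 * (4 : ℕ) + 8 < n' + M := by push_cast; omega
  have hsepm : h + 4 * (4 : ℕ) + 8 < n' + m := by push_cast; omega
  have hext := real_lr_extend_linear (k := k) hk (ρ := 4) le_rfl hh2 hhn hhn' (m := m) (by positivity) hM0 hsepM
    hsepm p hp0 hp1
  -- identify the pieces
  have e1 : P.real (slabConn k (boxR 0 n' 0 n') {z | z.1 = 0} {z | z.1 = n'}) = crossingProb k p (n - 1) (n - 1) := by
    rw [crossingProb_eq, hn']
    have : ((n - 1 : ℕ) : ℤ) = (n : ℤ) - 1 := by omega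
    rw [this]
  have e2 : P.real (slabConn k (boxR 0 (n' + m) 0 n') {z | z.1 = 0} {z | z.1 = n' + m}) =
      crossingProb k p (n - 1 + m) (n - 1) := by
    rw [crossingProb_eq, hn']
    have h1 : ((n - 1 : ℕ) : ℤ) = (n : ℤ) - 1 := by omega
    have h2 : ((n - 1 + m : ℕ) : ℤ) = (n : ℤ) - 1 + m := by omega
    rw [h1, h2]
  have e3 : P.real (slabConn k (boxR 0 (n' + M) 0 n') {z | z.1 = 0} {z | z.1 = n' + M}) =
      P.real (slabConn k (boxR a b r (r + n - 1)) {z | z.1 = a} {z | z.1 = b}) := by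
    have := real_lr_shift (k := k) (a, r) 0 (n' + M) 0 n' p
    simp only at this
    rw [← this]
    have ha : (0 : ℤ) + a = a := by ring
    have hb : n' + M + a = b := by rw [hM]; ring
    have hr : (0 : ℤ) + r = r := by ring
    have hr' : n' + r = r + n - 1 := by rw [hn']; ring
    rw [ha, hb, hr, hr']
  have e4 : P.real (slabConn k (boxR (-(m : ℤ)) (n' + M) 0 n') {z | z.1 = -(m : ℤ)} {z | z.1 = n' + M}) =
      P.real (slabConn k (boxR (a - m) b r (r + n - 1)) {z | z.1 = a - m} {z | z.1 = b}) := by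
    have := real_lr_shift (k := k) (a, r) (-(m : ℤ)) (n' + M) 0 n' p
    simp only at this
    rw [← this]
    have ha : -(m : ℤ) + a = a - m := by ring
    have hb : n' + M + a = b := by rw [hM]; ring
    have hr : (0 : ℤ) + r = r := by ring
    have hr' : n' + r = r + n - 1 := by rw [hn']; ring
    rw [ha, hb, hr, hr']
  rw [e1, e2, e3, e4] at hext
  -- divide by the constant
  have hK := glueK_pos k p
  have hext' : (1 - Real.sqrt (1 - crossingProb k p (n - 1) (n - 1))) ^ 2 * crossingProb k p (n - 1 + m) (n - 1) *
      P.real (slabConn k (boxR a b r (r + n - 1)) {z | z.1 = a} {z | z.1 = b}) ≤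
      glueK k p * P.real (slabConn k (boxR (a - m) b r (r + n - 1)) {z | z.1 = a - m} {z | z.1 = b}) := hext
  unfold extFactor
  rw [div_mul_eq_mul_div, div_le_iff₀ hK, mul_comm _ (glueK k p)]
  exact hext'

/-- **Right one-block extension in place**: `κ_m · P[[a,b] crossed] ≤ P[[a, b+m] crossed]` (the
left extension of the translate `[a+m, b+m]`). [cite: NewmanTassionWu2017, Theorem 3.10 (proof, (3.65))] -/
theorem real_lr_extend_right_ge (hk : 1 ≤ k) {n : ℕ} (hn : 52 ≤ n) {a b r : ℤ} (hab : (n : ℤ) - 1 ≤ b - a)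
    {m : ℕ} (hm : 1 ≤ m) (p : unitInterval) (hp0 : 0 < (p : ℝ)) (hp1 : (p : ℝ) < 1) :
    extFactor k p n m * (bondPercolation (slabGraph 3 k) p).real
        (slabConn k (boxR a b r (r + n - 1)) {z | z.1 = a} {z | z.1 = b}) ≤
      (bondPercolation (slabGraph 3 k) p).real
        (slabConn k (boxR a (b + m) r (r + n - 1)) {z | z.1 = a} {z | z.1 = b + m}) := by
  have h := real_lr_extend_left_ge (k := k) hk hn (a := a + m) (b := b + m) (r := r) (by omega) hm p hp0 hp1
  have hshift := real_lr_shift (k := k) ((m : ℤ), 0) a b r (r + n - 1) p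
  simp only [add_zero] at hshift
  rw [hshift, show a + (m : ℤ) - m = a by ring] at h
  exact h

/-! ## The four sides against their hubs -/

section Sides

variable {N n : ℕ}

/-- The extension constant `κ(c) = ((1 - √(1-c))² c / (K₁²K₂))³`. [cite: NewmanTassionWu2017, Theorem 3.10 (proof, (3.65): c₁ = c₁(c))] -/
def sideHubConst (k : ℕ) (p : unitInterval) (c : ℝ) : ℝ :=
  ((1 - Real.sqrt (1 - c)) ^ 2 * c / glueK k p) ^ 3

/-- `κ(c) ≥ 0` for `0 ≤ c ≤ 1`. [cite: NewmanTassionWu2017, Theorem 3.10 (proof, (3.65))] -/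
theorem sideHubConst_nonneg (k : ℕ) (p : unitInterval) {c : ℝ} (hc : 0 ≤ c) : 0 ≤ sideHubConst k p c := by
  unfold sideHubConst
  have := glueK_pos k p
  positivity

/-- The extension factors are bounded below by the hypothesis `c ≤ f(2n, n-1)`: for `m = n+1` and
`m = 1`, `κ_m ≥ (1 - √(1-c))² c / (K₁²K₂)`. [cite: NewmanTassionWu2017, Theorem 3.10 (proof, (3.65))] -/
theorem extFactor_ge {n : ℕ} (hn : 1 ≤ n) (p : unitInterval) {c : ℝ} (hc0 : 0 ≤ c)
    (hc : c ≤ crossingProb k p (2 * n) (n - 1)) {m : ℕ} (hm : m = n + 1 ∨ m = 1) :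
    (1 - Real.sqrt (1 - c)) ^ 2 * c / glueK k p ≤ extFactor k p n m := by
  have hK := glueK_pos k p
  have hc1 : c ≤ 1 := hc.trans (by rw [crossingProb_eq]; exact measureReal_le_one)
  -- the square and the short boxes are easier to cross than the hypothesis box
  have hsq : c ≤ crossingProb k p (n - 1) (n - 1) := hc.trans (crossingProb_mono p (by omega) le_rfl)
  have hshort : c ≤ crossingProb k p (n - 1 + m) (n - 1) := by
    rcases hm with rfl | rfl
    · have : n - 1 + (n + 1) = 2 * n := by omega
      rw [this]; exact hc
    · exact hc.trans (crossingProb_mono p (by omega) le_rfl)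
  have hsq1 : crossingProb k p (n - 1) (n - 1) ≤ 1 := by rw [crossingProb_eq]; exact measureReal_le_one
  unfold extFactor
  rw [div_le_div_iff_of_pos_right hK]
  have hg : 1 - Real.sqrt (1 - c) ≤ 1 - Real.sqrt (1 - crossingProb k p (n - 1) (n - 1)) := by
    gcongr
  have hg0 : 0 ≤ 1 - Real.sqrt (1 - c) := by
    rw [sub_nonneg, Real.sqrt_le_one]; linarith
  calc (1 - Real.sqrt (1 - c)) ^ 2 * c ≤ (1 - Real.sqrt (1 - crossingProb k p (n - 1) (n - 1))) ^ 2 * c := by gcongr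
    _ ≤ _ := by gcongr

/-- **Three extensions of a hub strip**: for a horizontal strip of the rows `[r, r+n-1]` (`n ≥ 52`,
`n ≤ N`): `κ(c) · P[[−N+1, N−1] crossed] ≤ P[[−N−n−e₁, N+n+e₂] crossed]` for
`(e₁, e₂) ∈ {(0,1), (1,0)}` (extensions by `n+1` at both ends and by one more line at one end).
[cite: NewmanTassionWu2017, Theorem 3.10 (proof, (3.65))] -/
theorem real_hubStrip_extend (hk : 1 ≤ k) (hn : 52 ≤ n) (hNn : n ≤ N) (r : ℤ) (p : unitInterval)
    (hp0 : 0 < (p : ℝ)) (hp1 : (p : ℝ) < 1) {c : ℝ} (hc0 : 0 ≤ c) (hc : c ≤ crossingProb k p (2 * n) (n - 1)) :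
    sideHubConst k p c * (bondPercolation (slabGraph 3 k) p).real
        (slabConn k (boxR (-(N : ℤ) + 1) ((N : ℤ) - 1) r (r + n - 1)) {z | z.1 = -(N : ℤ) + 1} {z | z.1 = (N : ℤ) - 1}) ≤
      (bondPercolation (slabGraph 3 k) p).real
        (slabConn k (boxR (-((N : ℤ) + n)) ((N : ℤ) + n + 1) r (r + n - 1)) {z | z.1 = -((N : ℤ) + n)}
          {z | z.1 = (N : ℤ) + n + 1}) ∧
    sideHubConst k p c * (bondPercolation (slabGraph 3 k) p).real
        (slabConn k (boxR (-(N : ℤ) + 1) ((N : ℤ) - 1) r (r + n - 1)) {z | z.1 = -(N : ℤ) + 1} {z | z.1 = (N : ℤ) - 1}) ≤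
      (bondPercolation (slabGraph 3 k) p).real
        (slabConn k (boxR (-((N : ℤ) + n + 1)) ((N : ℤ) + n) r (r + n - 1)) {z | z.1 = -((N : ℤ) + n + 1)}
          {z | z.1 = (N : ℤ) + n}) := by
  set P := bondPercolation (slabGraph 3 k) p with hP
  set κ₀ := (1 - Real.sqrt (1 - c)) ^ 2 * c / glueK k p with hκ₀
  have hκ₀0 : 0 ≤ κ₀ := by rw [hκ₀]; have := glueK_pos k p; positivity
  have hn1 : 1 ≤ n := by omega
  have hfn : κ₀ ≤ extFactor k p n (n + 1) := extFactor_ge hn1 p hc0 hc (Or.inl rfl)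
  have hf1 : κ₀ ≤ extFactor k p n 1 := extFactor_ge hn1 p hc0 hc (Or.inr rfl)
  have hkc : sideHubConst k p c = κ₀ * κ₀ * κ₀ := by rw [sideHubConst, hκ₀]; ring
  -- step 1: left extension by `n+1`: `[-N+1, N-1] → [-N-n, N-1]`
  have s1 := real_lr_extend_left_ge (k := k) hk hn (a := -(N : ℤ) + 1) (b := (N : ℤ) - 1) (r := r) (by omega)
    (m := n + 1) (by omega) p hp0 hp1
  have e1 : -(N : ℤ) + 1 - ((n + 1 : ℕ) : ℤ) = -((N : ℤ) + n) := by push_cast; ring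
  rw [e1] at s1
  set f0 := P.real (slabConn k (boxR (-(N : ℤ) + 1) ((N : ℤ) - 1) r (r + n - 1)) {z | z.1 = -(N : ℤ) + 1}
    {z | z.1 = (N : ℤ) - 1}) with hf0
  set f1 := P.real (slabConn k (boxR (-((N : ℤ) + n)) ((N : ℤ) - 1) r (r + n - 1)) {z | z.1 = -((N : ℤ) + n)}
    {z | z.1 = (N : ℤ) - 1}) with hf1def
  have hf0_0 : 0 ≤ f0 := measureReal_nonneg
  have t1 : κ₀ * f0 ≤ f1 := (mul_le_mul_of_nonneg_right hfn hf0_0).trans s1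
  refine ⟨?_, ?_⟩
  · -- T-shape: right by `n+1`, then right by `1`
    have s2 := real_lr_extend_right_ge (k := k) hk hn (a := -((N : ℤ) + n)) (b := (N : ℤ) - 1) (r := r)
      (by omega) (m := n + 1) (by omega) p hp0 hp1
    have e2 : (N : ℤ) - 1 + ((n + 1 : ℕ) : ℤ) = (N : ℤ) + n := by push_cast; ring
    rw [e2] at s2
    set f2 := P.real (slabConn k (boxR (-((N : ℤ) + n)) ((N : ℤ) + n) r (r + n - 1)) {z | z.1 = -((N : ℤ) + n)}
      {z | z.1 = (N : ℤ) + n}) with hf2def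
    have s3 := real_lr_extend_right_ge (k := k) hk hn (a := -((N : ℤ) + n)) (b := (N : ℤ) + n) (r := r)
      (by omega) (m := 1) le_rfl p hp0 hp1
    have e3 : (N : ℤ) + n + ((1 : ℕ) : ℤ) = (N : ℤ) + n + 1 := by push_cast; ring
    rw [e3] at s3
    have hf1_0 : 0 ≤ f1 := measureReal_nonneg
    have hf2_0 : 0 ≤ f2 := measureReal_nonneg
    have t2 : κ₀ * f1 ≤ f2 := (mul_le_mul_of_nonneg_right hfn hf1_0).trans s2
    have t3 : κ₀ * f2 ≤ _ := (mul_le_mul_of_nonneg_right hf1 hf2_0).trans s3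
    rw [hkc]
    calc κ₀ * κ₀ * κ₀ * f0 = κ₀ * (κ₀ * (κ₀ * f0)) := by ring
      _ ≤ κ₀ * (κ₀ * f1) := by gcongr
      _ ≤ κ₀ * f2 := by gcongr
      _ ≤ _ := t3
  · -- B-shape: left by `1`, then right by `n+1`
    have s2 := real_lr_extend_left_ge (k := k) hk hn (a := -((N : ℤ) + n)) (b := (N : ℤ) - 1) (r := r)
      (by omega) (m := 1) le_rfl p hp0 hp1
    have e2 : -((N : ℤ) + n) - ((1 : ℕ) : ℤ) = -((N : ℤ) + n + 1) := by push_cast; ring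
    rw [e2] at s2
    set f2 := P.real (slabConn k (boxR (-((N : ℤ) + n + 1)) ((N : ℤ) - 1) r (r + n - 1)) {z | z.1 = -((N : ℤ) + n + 1)}
      {z | z.1 = (N : ℤ) - 1}) with hf2def
    have s3 := real_lr_extend_right_ge (k := k) hk hn (a := -((N : ℤ) + n + 1)) (b := (N : ℤ) - 1) (r := r)
      (by omega) (m := n + 1) (by omega) p hp0 hp1
    have e3 : (N : ℤ) - 1 + ((n + 1 : ℕ) : ℤ) = (N : ℤ) + n := by push_cast; ring
    rw [e3] at s3
    have hf1_0 : 0 ≤ f1 := measureReal_nonneg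
    have hf2_0 : 0 ≤ f2 := measureReal_nonneg
    have t2 : κ₀ * f1 ≤ f2 := (mul_le_mul_of_nonneg_right hf1 hf1_0).trans s2
    have t3 : κ₀ * f2 ≤ _ := (mul_le_mul_of_nonneg_right hfn hf2_0).trans s3
    rw [hkc]
    calc κ₀ * κ₀ * κ₀ * f0 = κ₀ * (κ₀ * (κ₀ * f0)) := by ring
      _ ≤ κ₀ * (κ₀ * f1) := by gcongr
      _ ≤ κ₀ * f2 := by gcongr
      _ ≤ _ := t3

/-- **`κ(c) · P[hubCross_X] ≤ P[sideCross_X]` for the four sides** (NTW (3.65) in the port's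
geometry): the constant `κ(c) = sideHubConst k p c` does not depend on `N` (`n ≥ 52`, `n ≤ N`,
`0 < p < 1`, `0 ≤ c ≤ f_p(2n, n-1)`). [cite: NewmanTassionWu2017, Theorem 3.10 (proof, (3.65))] -/
theorem real_sideCross_ge_hubCross (hk : 1 ≤ k) (hn : 52 ≤ n) (hNn : n ≤ N) (p : unitInterval)
    (hp0 : 0 < (p : ℝ)) (hp1 : (p : ℝ) < 1) {c : ℝ} (hc0 : 0 ≤ c) (hc : c ≤ crossingProb k p (2 * n) (n - 1)) :
    sideHubConst k p c * (bondPercolation (slabGraph 3 k) p).real (hubCrossT k N n) ≤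
        (bondPercolation (slabGraph 3 k) p).real (sideCrossT k N n) ∧
      sideHubConst k p c * (bondPercolation (slabGraph 3 k) p).real (hubCrossR k N n) ≤
        (bondPercolation (slabGraph 3 k) p).real (sideCrossR k N n) ∧
      sideHubConst k p c * (bondPercolation (slabGraph 3 k) p).real (hubCrossB k N n) ≤
        (bondPercolation (slabGraph 3 k) p).real (sideCrossB k N n) ∧
      sideHubConst k p c * (bondPercolation (slabGraph 3 k) p).real (hubCrossL k N n) ≤
        (bondPercolation (slabGraph 3 k) p).real (sideCrossL k N n) := by
  refine ⟨?_, ?_, ?_, ?_⟩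
  · -- top: rows `[N+1, N+n]`, T-shape
    have h := (real_hubStrip_extend (k := k) hk hn hNn ((N : ℤ) + 1) p hp0 hp1 hc0 hc).1
    have e : (N : ℤ) + 1 + n - 1 = (N : ℤ) + n := by ring
    rw [e] at h
    exact h
  · -- right: transpose to rows `[N+1, N+n]`, B-shape
    have h := (real_hubStrip_extend (k := k) hk hn hNn ((N : ℤ) + 1) p hp0 hp1 hc0 hc).2
    have e : (N : ℤ) + 1 + n - 1 = (N : ℤ) + n := by ring
    rw [e] at h
    have eh : (bondPercolation (slabGraph 3 k) p).real (hubCrossR k N n) =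
        (bondPercolation (slabGraph 3 k) p).real
          (slabConn k (boxR (-(N : ℤ) + 1) ((N : ℤ) - 1) ((N : ℤ) + 1) ((N : ℤ) + n)) {z | z.1 = -(N : ℤ) + 1}
            {z | z.1 = (N : ℤ) - 1}) := by
      rw [hubCrossR, hubR]; exact real_bt_eq_lr _ _ _ _ p
    have es : (bondPercolation (slabGraph 3 k) p).real (sideCrossR k N n) =
        (bondPercolation (slabGraph 3 k) p).real
          (slabConn k (boxR (-((N : ℤ) + n + 1)) ((N : ℤ) + n) ((N : ℤ) + 1) ((N : ℤ) + n))
            {z | z.1 = -((N : ℤ) + n + 1)} {z | z.1 = (N : ℤ) + n}) := by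
      have ec : sideCrossR k N n = slabConn k (ringSideR N n) {z | z.2 = -((N : ℤ) + n + 1)} {z | z.2 = (N : ℤ) + n} :=
        Set.ext fun ω => ⟨fun h => slabConn_comm h, fun h => slabConn_comm h⟩
      rw [ec, ringSideR]; exact real_bt_eq_lr _ _ _ _ p
    rw [eh, es]; exact h
  · -- bottom: rows `[-N-n, -N-1]`, B-shape
    have h := (real_hubStrip_extend (k := k) hk hn hNn (-((N : ℤ) + n)) p hp0 hp1 hc0 hc).2
    have e : -((N : ℤ) + n) + n - 1 = -((N : ℤ) + 1) := by ring
    rw [e] at h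
    have es : (bondPercolation (slabGraph 3 k) p).real (sideCrossB k N n) =
        (bondPercolation (slabGraph 3 k) p).real
          (slabConn k (boxR (-((N : ℤ) + n + 1)) ((N : ℤ) + n) (-((N : ℤ) + n)) (-((N : ℤ) + 1)))
            {z | z.1 = -((N : ℤ) + n + 1)} {z | z.1 = (N : ℤ) + n}) := by
      exact congrArg _ (Set.ext fun ω => ⟨fun h => slabConn_comm h, fun h => slabConn_comm h⟩)
    rw [es]; exact h
  · -- left: transpose to rows `[-N-n, -N-1]`, T-shape
    have h := (real_hubStrip_extend (k := k) hk hn hNn (-((N : ℤ) + n)) p hp0 hp1 hc0 hc).1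
    have e : -((N : ℤ) + n) + n - 1 = -((N : ℤ) + 1) := by ring
    rw [e] at h
    have eh : (bondPercolation (slabGraph 3 k) p).real (hubCrossL k N n) =
        (bondPercolation (slabGraph 3 k) p).real
          (slabConn k (boxR (-(N : ℤ) + 1) ((N : ℤ) - 1) (-((N : ℤ) + n)) (-((N : ℤ) + 1))) {z | z.1 = -(N : ℤ) + 1}
            {z | z.1 = (N : ℤ) - 1}) := by
      rw [hubCrossL, hubL]; exact real_bt_eq_lr _ _ _ _ p
    have es : (bondPercolation (slabGraph 3 k) p).real (sideCrossL k N n) =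
        (bondPercolation (slabGraph 3 k) p).real
          (slabConn k (boxR (-((N : ℤ) + n)) ((N : ℤ) + n + 1) (-((N : ℤ) + n)) (-((N : ℤ) + 1)))
            {z | z.1 = -((N : ℤ) + n)} {z | z.1 = (N : ℤ) + n + 1}) := by
      rw [sideCrossL, ringSideL]; exact real_bt_eq_lr _ _ _ _ p
    rw [eh, es]; exact h

end Sides

end NTW17

end Literature.Probability.Percolation

end
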